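import Literature.MathematicalPhysics.QuantumFieldTheory.Balaban1983to89.Node00.Record13SepCoPInhabitedOfThm1CCMGaugeR
import Summits.QuantumFields.YangMills.Theorems.BalabanUVNodesN07Thm1Top7FromProp8

/-!
# BalabanUVNodes ∕ K0 ROAD — THE `4 ≤ F.m` BRANCH OF plan g75's V14 STUB 3 `K0ROfStepTokensRAt F`, COMPOSED: the ⁶ ∕ ⁷ K0 bodies for `F` at `N = 2` from EXACTLY
# [15] Proposition 8's top step (`Prop8RegSepTopStep`, N07), [6] Proposition 6 at NODE 00's ℤᵈ cube member (`B8.Prop6Printed … (zdCub …)`, N05), the β-box of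
# `betaOfRecord₁₃ F 2 θ₁₅ᶜᶜᴹ(3)` and the signs — at the collared witness `M = M₁ = L³`, floor `c = (11·4 + 3·L)·L`

Cell `pub-ymgap`, seat `pub-ymgap-dag-n21-c` (g11), pens (γ)+(β) of dag-lead WORDS-144∕145; FILE C (Summits side because dag-n07-e's bridge `variationalThm1RegSepCoP7M_of_prop8TopStep`
lives here).  Consumed BY NAME: dag-n07-e FILE 29 `Node00.TorusCoverGaugeTokensR` (`gauge152R_of_prop6`, `gauge9R_of_prop8TopStep_of_gauge152R`, `b9Of`, `a0Of`, `a0Of_pos`, `b9Of_pos`),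
`…N07Thm1Top7FromProp8` (`variationalThm1RegSepCoP7M_of_prop8TopStep`), this seat's FILE B `Node00.Record13SepCoPInhabitedOfThm1CCMGaugeR`
(`exists_k0SepCoPR_of_thm1RegSepCoP7M_of_gauge9TopStepR_of_betaBox_cube`, `exists_k0SepCoPH_of_exists_k0SepCoPR`).  `--kind proof --supports stmt-QuantumFields-20541 --as helper`.
[15] = [Balaban1985Variational]; [6] = [Balaban1985RegularSpaces]; [III] = [Balaban1988Convergent]; [I] = [Balaban1987RG1]; [IV] = [Balaban1989LargeFieldI].

WHAT THIS FILE PROVES (theorems only).  ★★★ `exists_k0R_of_prop8TopStep_of_prop6Member_of_betaBox (F) (hm : 4 ≤ F.m) (hB₃ : 2L² ≤ B₃) (ha₀) (ha₁) (h8 : Prop8RegSepTopStep F 2 suppDom B₃ a₀ a₁)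
(hB₁) (hc₁) (hP6 : B8.Prop6Printed 4 F.L B₁ c₁ (zdCub (MatA 2) F.L ·)) (hε) (hε') (hb) (hlow) (hup) (hβ')` ⊢ the ⁶ body, where the β-box is read at the collared witness
`theta13OfThm1CCM F 2 3 ε₀ ε₂₉ B₃ (b9Of F (F.L ^ 3) B₁ * B₃) a₀ (min a₁ (a0Of F 2 (F.L ^ 3) B₁ c₁ ∕ B₃))` — print's (9) constant `B₃' = B₉·B₃` and the ceiling `a₁' = min a₁ (a₀''∕B₃)` of
`gauge9R_of_prop8TopStep_of_gauge152R`; ★★★ `exists_k0H_of_prop8TopStep_of_prop6Member_of_betaBox` ⊢ the ⁷ body (history-blind door).  The composition: Prop. 6 member ⇒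
`Gauge152OfClassTopStepR … (L³) ((44+3L)L) (b9Of) (a0Of)` (FILE 29) ⇒ with Prop. 8 (shrunk to `a₁'`) `Gauge9RegSepTopStepR … B₃ (B₉·B₃) a₀ a₁'`; Prop. 8 ⇒ (8) `VariationalThm1RegSepCoP7M`
(N07's bridge); FILE B's `_cube` closer at `4 ≤ F.m`.

HONEST FRAMING.  A composition of tree theorems; CONDITIONAL on [15] Prop. 8's top step (N07's node), [6] Prop. 6 at the member (N05's node), the β-box at the collared witness and
the signs — all DISPLAYED hypotheses, never asserted; the `F.m ≤ 3` families are NOT covered (plan g75 LOCATED (δ)); nothing of Bałaban asserted or discharged; K0⁷ NOT closed;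
counts unmoved (typed 28∕28 · discharged 5∕27); one finite 𝕋⁴ programme at fixed ε — NOT continuum ∕ OS ∕ mass gap ∕ Clay.  No `sorry`, `def`, `instance`, `notation`.
-/

noncomputable section

open scoped Matrix.Norms.L2Operator

namespace Summit.QuantumFields.YangMills.Theorems.K0ROfStepTokensRCube

open Literature.MathematicalPhysics.QuantumFieldTheory.Balaban1983to89
open Literature.MathematicalPhysics.QuantumFieldTheory.Balaban1983to89.T4Continuum
open Literature.MathematicalPhysics.QuantumFieldTheory.Balaban1983to89.Node00
open Literature.MathematicalPhysics.QuantumFieldTheory.Balaban1983to89.FlowStep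
open Summit.QuantumFields.YangMills.BalabanUVNodes.N07Thm1Top7FromProp8 (variationalThm1RegSepCoP7M_of_prop8TopStep)

variable (F : T4Family)

/-- **THE SHRUNK CEILING IS POSITIVE**: `0 < min a₁ (a0Of F 2 M B₁ c₁ ∕ B₃)` for `0 < a₁`, `0 ≤ B₁`, `0 < c₁`, `0 < B₃`. [cite: Balaban1985Variational, (152) p.301 («9dL²Mε₀ ≦ c₁»; bookkeeping)] -/
theorem shrunkCeiling_pos (M : ℕ) {B₃ B₁ c₁ a₁ : ℝ} (hB₃ : 0 < B₃) (hB₁ : 0 ≤ B₁) (hc₁ : 0 < c₁) (ha₁ : 0 < a₁) :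
    0 < min a₁ (a0Of F 2 M B₁ c₁ / B₃) :=
  lt_min ha₁ (div_pos (a0Of_pos (F := F) (N := 2) M hB₁ hc₁) hB₃)

/-- **THE SHRUNK CEILING MEETS THE BRIDGE'S SMALLNESS** `B₃ · min a₁ (a₀''∕B₃) ≤ a₀''`. [cite: Balaban1985Variational, (152) p.301, Thm 1 p.279 («B₃ε₁ ≤ ε₀»; bookkeeping)] -/
theorem mul_shrunkCeiling_le (M : ℕ) {B₃ B₁ c₁ a₁ : ℝ} (hB₃ : 0 < B₃) :
    B₃ * min a₁ (a0Of F 2 M B₁ c₁ / B₃) ≤ a0Of F 2 M B₁ c₁ :=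
  calc B₃ * min a₁ (a0Of F 2 M B₁ c₁ / B₃) ≤ B₃ * (a0Of F 2 M B₁ c₁ / B₃) := mul_le_mul_of_nonneg_left (min_le_right _ _) hB₃.le
    _ = a0Of F 2 M B₁ c₁ := mul_div_cancel₀ _ hB₃.ne'

/-- **★ THE FLOOR-CARRYING (9)-STEP AT THE COLLARED CUBE LETTER FROM THE TWO PRINTED INPUTS**: [15] Prop. 8's top step at `(B₃, a₀, a₁)` and [6] Prop. 6 at NODE 00's member give
dag-n07-e's `Gauge9RegSepTopStepR F 2 suppDom (L³) ((11·4+3L)·L) B₃ (b9Of·B₃) a₀ (min a₁ (a0Of∕B₃))` (FILE 29's `gauge152R_of_prop6` ∘ `gauge9R_of_prop8TopStep_of_gauge152R`, Prop. 8 shrunk by `.of_le`).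
CONDITIONAL on both inputs. [cite: Balaban1985Variational, Thm 1 (8)–(9) p.279, Sect. F pp.300–305, (152) p.301, Prop. 8 p.304; Balaban1985RegularSpaces, Prop. 6 p.99] -/
theorem gauge9R_cube_of_prop8TopStep_of_prop6Member {B₃ a₀ a₁ B₁ c₁ : ℝ} (hB₃ : 0 < B₃)
    (h8 : Prop8RegSepTopStep F 2 (fun ν K Ω => suppDomOfRecord F ν K Ω) B₃ a₀ a₁) (hB₁ : 0 ≤ B₁) (hc₁ : 0 < c₁)
    (hP6 : letI : CStarAlgebra (MatA 2) := {}; B8.Prop6Printed 4 (F.L : ℝ) B₁ c₁ (fun i : B8LeafModelZd.ZdIdx 4 F.L => zdCub (MatA 2) F.L i)) :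
    Gauge9RegSepTopStepR F 2 (fun ν K Ω => suppDomOfRecord F ν K Ω) (F.L ^ 3) ((11 * 4 + 3 * F.L) * F.L) B₃ (b9Of F (F.L ^ 3) B₁ * B₃) a₀
      (min a₁ (a0Of F 2 (F.L ^ 3) B₁ c₁ / B₃)) :=
  gauge9R_of_prop8TopStep_of_gauge152R (h8.of_le le_rfl (min_le_left _ _)) (gauge152R_of_prop6 hB₁ hc₁ hP6 (F.L ^ 3)) hB₃ (mul_shrunkCeiling_le F (F.L ^ 3) hB₃)

/-- **★★★ THE ⁶ K0 BODY FOR `F` (`4 ≤ F.m`) AT `N = 2` FROM [15] PROP. 8's TOP STEP, [6] PROP. 6 AT NODE 00's MEMBER, THE β-BOX AT THE COLLARED WITNESS `θ₁₅ᶜᶜᴹ(3)` AND THE SIGNS** — the `4 ≤ F.m`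
branch of plan g75's V14 stub 3 with stubs 1 and 2 as displayed inputs: Prop. 8 ⇒ (8) `VariationalThm1RegSepCoP7M` (N07's bridge) and, with Prop. 6, the R (9)-step at `(L³, (44+3L)L)`
(`gauge9R_cube_…`); FILE B's `_cube` closer at the witness with `B₃' := b9Of·B₃`, `a₁' := min a₁ (a0Of∕B₃)`.  CONDITIONAL on every displayed hypothesis; K0⁶∕K0⁷ NOT closed here.
[cite: Balaban1985Variational, (6)–(7) p.278, Thm 1 (8)–(9) p.279, (144)–(152) pp.300–301, Prop. 8 p.304; Balaban1985RegularSpaces, (1.3)–(1.9) p.77, Prop. 6 p.99; Balaban1988Convergent, Thm 1 p.262, (2.4)–(2.8) pp.255–256, (2.12)–(2.13) p.256, (2.27)–(2.28) p.259, (2.34)–(2.41) p.261, (3.16)–(3.22) pp.268–269; Balaban1987RG1, (0.1) p.251, (0.20) p.256, (1.11)–(1.12) p.262, §1 p.264; Balaban1989LargeFieldI, (0.3)–(0.4) p.176] -/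
theorem exists_k0R_of_prop8TopStep_of_prop6Member_of_betaBox (hm : 4 ≤ F.m) {B₃ a₀ a₁ B₁ c₁ : ℝ} (hB₃ : 2 * (F.L : ℝ) ^ 2 ≤ B₃) (ha₀ : 0 < a₀) (ha₁ : 0 < a₁)
    (h8 : Prop8RegSepTopStep F 2 (fun ν K Ω => suppDomOfRecord F ν K Ω) B₃ a₀ a₁) (hB₁ : 0 ≤ B₁) (hc₁ : 0 < c₁)
    (hP6 : letI : CStarAlgebra (MatA 2) := {}; B8.Prop6Printed 4 (F.L : ℝ) B₁ c₁ (fun i : B8LeafModelZd.ZdIdx 4 F.L => zdCub (MatA 2) F.L i))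
    {ε₀ ε₂₉ b β' : ℝ} (hε : 0 < ε₀) (hε' : 0 < ε₂₉) (hb : 0 ≤ b)
    (hlow : BetaLowerH b (1 / 2) (betaOfRecord₁₃ F 2
      (theta13OfThm1CCM F 2 3 ε₀ ε₂₉ B₃ (b9Of F (F.L ^ 3) B₁ * B₃) a₀ (min a₁ (a0Of F 2 (F.L ^ 3) B₁ c₁ / B₃)))))
    (hup : BetaUpperH β' (1 / 2) (betaOfRecord₁₃ F 2
      (theta13OfThm1CCM F 2 3 ε₀ ε₂₉ B₃ (b9Of F (F.L ^ 3) B₁ * B₃) a₀ (min a₁ (a0Of F 2 (F.L ^ 3) B₁ c₁ / B₃))))) (hβ' : β' ≤ 3) :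
    ∃ θ : Stage13RParams F 2, θ.Provisos₁₃SepCoPR F 2 ∧ (θ.ZrUnity F 2 ∧ θ.SlotsNondegenerate₁₃ F 2) ∧ θ.Admissible F 2 := by
  have hL : (0 : ℝ) < (F.L : ℝ) := by exact_mod_cast lt_trans Nat.zero_lt_one F.hL.2
  have hBpos : (0 : ℝ) < B₃ := lt_of_lt_of_le (mul_pos two_pos (pow_pos hL 2)) hB₃
  have hB9 : 0 ≤ b9Of F (F.L ^ 3) B₁ * B₃ := mul_nonneg (b9Of_pos (F := F) (F.L ^ 3) hB₁).le hBpos.le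
  exact exists_k0SepCoPR_of_thm1RegSepCoP7M_of_gauge9TopStepR_of_betaBox_cube F hm hε hε' hBpos.le hB9 ha₀ (shrunkCeiling_pos F (F.L ^ 3) hBpos hB₁ hc₁ ha₁)
    (variationalThm1RegSepCoP7M_of_prop8TopStep hBpos (h8.of_le le_rfl (min_le_left _ _))) (gauge9R_cube_of_prop8TopStep_of_prop6Member F hBpos h8 hB₁ hc₁ hP6)
    hb hlow hup hβ'

/-- **★★★ THE ⁷ K0 BODY FOR `F` (`4 ≤ F.m`)** — K0⁷ `Record13SepCoPHInhabited`'s body at `F` from the same four displayed inputs (history-blind door ∘ ★★★).  CONDITIONAL; K0⁷ NOT closed here.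
[cite: Balaban1985Variational, Thm 1 (8)–(9) p.279, Prop. 8 p.304; Balaban1985RegularSpaces, Prop. 6 p.99; Balaban1988Convergent, Thm 1 p.262, (2.21) p.258, (3.16)–(3.23) pp.268–270; Balaban1989LargeFieldI, (0.2)–(0.4) p.176] -/
theorem exists_k0H_of_prop8TopStep_of_prop6Member_of_betaBox (hm : 4 ≤ F.m) {B₃ a₀ a₁ B₁ c₁ : ℝ} (hB₃ : 2 * (F.L : ℝ) ^ 2 ≤ B₃) (ha₀ : 0 < a₀) (ha₁ : 0 < a₁)
    (h8 : Prop8RegSepTopStep F 2 (fun ν K Ω => suppDomOfRecord F ν K Ω) B₃ a₀ a₁) (hB₁ : 0 ≤ B₁) (hc₁ : 0 < c₁)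
    (hP6 : letI : CStarAlgebra (MatA 2) := {}; B8.Prop6Printed 4 (F.L : ℝ) B₁ c₁ (fun i : B8LeafModelZd.ZdIdx 4 F.L => zdCub (MatA 2) F.L i))
    {ε₀ ε₂₉ b β' : ℝ} (hε : 0 < ε₀) (hε' : 0 < ε₂₉) (hb : 0 ≤ b)
    (hlow : BetaLowerH b (1 / 2) (betaOfRecord₁₃ F 2
      (theta13OfThm1CCM F 2 3 ε₀ ε₂₉ B₃ (b9Of F (F.L ^ 3) B₁ * B₃) a₀ (min a₁ (a0Of F 2 (F.L ^ 3) B₁ c₁ / B₃)))))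
    (hup : BetaUpperH β' (1 / 2) (betaOfRecord₁₃ F 2
      (theta13OfThm1CCM F 2 3 ε₀ ε₂₉ B₃ (b9Of F (F.L ^ 3) B₁ * B₃) a₀ (min a₁ (a0Of F 2 (F.L ^ 3) B₁ c₁ / B₃))))) (hβ' : β' ≤ 3) :
    ∃ θ : Stage13HParams F 2, θ.Provisos₁₃SepCoPH F 2 ∧ (θ.ZhUnity F 2 ∧ θ.SlotsNondegenerate₁₃ F 2) ∧ θ.Admissible F 2 :=
  exists_k0SepCoPH_of_exists_k0SepCoPR (exists_k0R_of_prop8TopStep_of_prop6Member_of_betaBox F hm hB₃ ha₀ ha₁ h8 hB₁ hc₁ hP6 hε hε' hb hlow hup hβ')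

end Summit.QuantumFields.YangMills.Theorems.K0ROfStepTokensRCube

end
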